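import Mathlib

/-!
# Hodge locus census — the LEVEL FORMULA behind T-1728@2 (engine A, abs-1 gen 23)

certified instances and evidence bearing on the general Hodge conjecture; no claim.

Companion to `HodgeLocusCensusValJ1728At2.lean`.  In the derivation of THEOREM T-1728@2
(DERIVATION-caseB-A.md §2(5)) the Gross–Keating length of the pair `(U, y)` at `p = 2`,
`U² = -1`, `y² = -N`, is `ℓ + 1` where the quasi-canonical level is
`ℓ = max { m : y ∈ ℤ₂[U] + Π^m O_B } = max_{s,t} v₂(Nrd(y - s - tU)) = max_{s,t} v₂(s² + t² + M)`,
`M = N - b_U² = c² + d²` a non-zero sum of two squares (`Π^m O_B = {v₂ Nrd ≥ m}` in the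
ramified quaternion algebra over `ℚ₂`).  The elementary claim used there is

  `max_{s,t ∈ ℤ} v₂(s² + t² + M) = 1 + v₂(M)`   for every non-zero sum of two squares `M`.

This file proves it over `ℕ` (squares of integers are squares of naturals):
* `odd_part_mod_four`  — the odd part of a non-zero sum of two squares is `≡ 1 (mod 4)`;
* `level_upper`        — `u ≡ 1 (mod 4) → ¬ 2^(k+2) ∣ s² + t² + 2^k u` (all `s t`);
* `level_le`           — valuation form: `v₂(s² + t² + M) ≤ v₂(M) + 1` for `M = c² + d² ≠ 0`;
* `level_attained`     — equality at `(s, t) = (c, d)`;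
so that the Gross–Keating length is `2 + v₂(M)` (`gkLength_one` of the companion file).
Only elementary arithmetic (squares mod 4 and mod 8, 2-descent); no new definitions.
References: [KudlaRapoportYang2006, §3.6 (3.6.10)–(3.6.13)], [Gross1986CanonicalLiftings].
-/

namespace Summit.HodgeConjecture.HodgeConjecture.HodgeLocus.Census.ValJ1728At2Level

/-- Squares modulo 4, sorted by the parity of the root. -/
theorem sq_mod_four_cases (s : ℕ) :
    (s % 2 = 0 ∧ s ^ 2 % 4 = 0) ∨ (s % 2 = 1 ∧ s ^ 2 % 4 = 1) := by
  have h4 : s % 4 < 4 := Nat.mod_lt _ (by norm_num)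
  have hsq : s ^ 2 % 4 = (s % 4) ^ 2 % 4 := Nat.pow_mod s 2 4
  have h2 : s % 2 = s % 4 % 2 := by omega
  interval_cases h : s % 4 <;> simp_all

/-- Squares modulo 8 are `0`, `1` or `4`. -/
theorem sq_mod_eight (s : ℕ) : s ^ 2 % 8 = 0 ∨ s ^ 2 % 8 = 1 ∨ s ^ 2 % 8 = 4 := by
  have h8 : s % 8 < 8 := Nat.mod_lt _ (by norm_num)
  have hsq : s ^ 2 % 8 = (s % 8) ^ 2 % 8 := Nat.pow_mod s 2 8
  interval_cases h : s % 8 <;> simp_all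

/-- `k = 0`: `u ≡ 1 (mod 4)` ⇒ `4 ∤ s² + t² + u`. -/
theorem not_four_dvd (s t u : ℕ) (hu : u % 4 = 1) : ¬ 4 ∣ s ^ 2 + t ^ 2 + u := by
  rcases sq_mod_four_cases s with ⟨-, hs⟩ | ⟨-, hs⟩ <;>
  rcases sq_mod_four_cases t with ⟨-, ht⟩ | ⟨-, ht⟩ <;> omega

/-- `k = 1`: `u ≡ 1 (mod 4)` ⇒ `8 ∤ s² + t² + 2u`. -/
theorem not_eight_dvd (s t u : ℕ) (hu : u % 4 = 1) : ¬ 8 ∣ s ^ 2 + t ^ 2 + 2 * u := by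
  rcases sq_mod_eight s with hs | hs | hs <;>
  rcases sq_mod_eight t with ht | ht | ht <;> omega

/-- 2-descent: `4 ∣ s² + t²` forces `s` and `t` even. -/
theorem even_of_four_dvd (s t : ℕ) (h : 4 ∣ s ^ 2 + t ^ 2) : 2 ∣ s ∧ 2 ∣ t := by
  rcases sq_mod_four_cases s with ⟨hs2, hs⟩ | ⟨hs2, hs⟩ <;>
  rcases sq_mod_four_cases t with ⟨ht2, ht⟩ | ⟨ht2, ht⟩ <;> omega

/-- The two-step induction packaged as an ordinary induction on `k`:
`u ≡ 1 (mod 4)` ⇒ `2^(k+2) ∤ s² + t² + 2^k u` and `2^(k+3) ∤ s² + t² + 2^(k+1) u`. -/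
theorem level_upper_aux (k : ℕ) :
    (∀ s t u : ℕ, u % 4 = 1 → ¬ 2 ^ (k + 2) ∣ s ^ 2 + t ^ 2 + 2 ^ k * u) ∧
    (∀ s t u : ℕ, u % 4 = 1 → ¬ 2 ^ (k + 3) ∣ s ^ 2 + t ^ 2 + 2 ^ (k + 1) * u) := by
  induction k with
  | zero =>
    refine ⟨?_, ?_⟩
    · intro s t u hu h
      exact not_four_dvd s t u hu (by simpa using h)
    · intro s t u hu h
      exact not_eight_dvd s t u hu (by simpa using h)
  | succ k ih =>
    refine ⟨?_, ?_⟩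
    · intro s t u hu h
      simpa [Nat.add_assoc] using ih.2 s t u hu h
    · intro s t u hu h
      -- 2^(k+4) ∣ s² + t² + 2^(k+2) u : descend.
      have h4 : (4 : ℕ) ∣ s ^ 2 + t ^ 2 + 2 ^ (k + 1 + 1) * u :=
        Nat.dvd_trans ⟨2 ^ (k + 2), by ring⟩ h
      have h4' : (4 : ℕ) ∣ 2 ^ (k + 1 + 1) * u := ⟨2 ^ k * u, by ring⟩
      have hst : 4 ∣ s ^ 2 + t ^ 2 := by
        clear ih h
        omega
      obtain ⟨⟨s', rfl⟩, ⟨t', rfl⟩⟩ := even_of_four_dvd s t hst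
      have key : (2 * s') ^ 2 + (2 * t') ^ 2 + 2 ^ (k + 1 + 1) * u
          = 4 * (s' ^ 2 + t' ^ 2 + 2 ^ k * u) := by ring
      rw [key, show (2 : ℕ) ^ (k + 1 + 3) = 4 * 2 ^ (k + 2) by ring] at h
      exact ih.1 s' t' u hu (Nat.dvd_of_mul_dvd_mul_left (by norm_num) h)

/-- LEVEL UPPER BOUND: `u ≡ 1 (mod 4)` ⇒ `2^(k+2) ∤ s² + t² + 2^k u`. -/
theorem level_upper (k s t u : ℕ) (hu : u % 4 = 1) :
    ¬ 2 ^ (k + 2) ∣ s ^ 2 + t ^ 2 + 2 ^ k * u :=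
  (level_upper_aux k).1 s t u hu

/-- The odd part of a non-zero sum of two squares is `≡ 1 (mod 4)` (two-step 2-descent). -/
theorem odd_part_mod_four_aux (k : ℕ) :
    (∀ c d u : ℕ, u % 2 = 1 → c ^ 2 + d ^ 2 = 2 ^ k * u → u % 4 = 1) ∧
    (∀ c d u : ℕ, u % 2 = 1 → c ^ 2 + d ^ 2 = 2 ^ (k + 1) * u → u % 4 = 1) := by
  induction k with
  | zero =>
    refine ⟨?_, ?_⟩
    · intro c d u hu h
      rcases sq_mod_four_cases c with ⟨-, hc⟩ | ⟨-, hc⟩ <;>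
      rcases sq_mod_four_cases d with ⟨-, hd⟩ | ⟨-, hd⟩ <;> simp at h <;> omega
    · intro c d u hu h
      rcases sq_mod_eight c with hc | hc | hc <;>
      rcases sq_mod_eight d with hd | hd | hd <;> simp at h <;> omega
  | succ k ih =>
    refine ⟨?_, ?_⟩
    · intro c d u hu h
      exact ih.2 c d u hu (by simpa using h)
    · intro c d u hu h
      have hst : 4 ∣ c ^ 2 + d ^ 2 := ⟨2 ^ k * u, by rw [h]; ring⟩
      obtain ⟨⟨c', rfl⟩, ⟨d', rfl⟩⟩ := even_of_four_dvd c d hst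
      have h' : c' ^ 2 + d' ^ 2 = 2 ^ k * u := by
        have : 4 * (c' ^ 2 + d' ^ 2) = 4 * (2 ^ k * u) := by
          have := h; ring_nf at this ⊢; omega
        omega
      exact ih.1 c' d' u hu h'

/-- ODD PART: if `c² + d² = 2^k u` with `u` odd then `u ≡ 1 (mod 4)`. -/
theorem odd_part_mod_four (c d k u : ℕ) (hu : u % 2 = 1) (h : c ^ 2 + d ^ 2 = 2 ^ k * u) :
    u % 4 = 1 :=
  (odd_part_mod_four_aux k).1 c d u hu h

/-- `v₂(2^k u) = k` for odd `u`. -/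
theorem v2_two_pow_mul_odd (k u : ℕ) (hu : u % 2 = 1) : padicValNat 2 (2 ^ k * u) = k := by
  have hu0 : u ≠ 0 := by omega
  have hnd : ¬ 2 ∣ u := by omega
  rw [padicValNat.mul (by positivity) hu0, padicValNat.prime_pow,
    padicValNat.eq_zero_of_not_dvd hnd, Nat.add_zero]

/-- Decomposition `M = 2^(v₂ M) · u` with `u` odd, for `M ≠ 0`. -/
theorem exists_odd_part (M : ℕ) (hM : M ≠ 0) :
    ∃ u : ℕ, u % 2 = 1 ∧ M = 2 ^ padicValNat 2 M * u := by
  obtain ⟨u, hu⟩ := pow_padicValNat_dvd (p := 2) (n := M)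
  refine ⟨u, ?_, hu⟩
  by_contra hodd
  have h2u : 2 ∣ u := by omega
  obtain ⟨w, rfl⟩ := h2u
  have : 2 ^ (padicValNat 2 M + 1) ∣ M := by
    refine ⟨w, hu.trans ?_⟩
    ring
  exact pow_succ_padicValNat_not_dvd hM this

/-- LEVEL FORMULA, valuation form (upper bound): for a non-zero sum of two squares
`M = c² + d²` and all `s, t`: `v₂(s² + t² + M) ≤ v₂(M) + 1`. -/
theorem level_le (c d s t : ℕ) (hM : c ^ 2 + d ^ 2 ≠ 0) :
    padicValNat 2 (s ^ 2 + t ^ 2 + (c ^ 2 + d ^ 2)) ≤ padicValNat 2 (c ^ 2 + d ^ 2) + 1 := by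
  set M := c ^ 2 + d ^ 2 with hMdef
  obtain ⟨u, hu, hMu⟩ := exists_odd_part M hM
  set k := padicValNat 2 M with hk
  have hu4 : u % 4 = 1 := odd_part_mod_four c d k u hu (by rw [← hMdef, hMu])
  have hnd : ¬ 2 ^ (k + 2) ∣ s ^ 2 + t ^ 2 + M := by rw [hMu]; exact level_upper k s t u hu4
  have hne : s ^ 2 + t ^ 2 + M ≠ 0 := by omega
  by_contra hlt
  have hle : k + 2 ≤ padicValNat 2 (s ^ 2 + t ^ 2 + M) := by omega
  exact hnd ((padicValNat_dvd_iff_le hne).mpr hle)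

/-- LEVEL FORMULA, attained: at `(s, t) = (c, d)` the value is `v₂(M) + 1` (`s² + t² + M = 2M`). -/
theorem level_attained (c d : ℕ) (hM : c ^ 2 + d ^ 2 ≠ 0) :
    padicValNat 2 (c ^ 2 + d ^ 2 + (c ^ 2 + d ^ 2)) = padicValNat 2 (c ^ 2 + d ^ 2) + 1 := by
  rw [show c ^ 2 + d ^ 2 + (c ^ 2 + d ^ 2) = 2 * (c ^ 2 + d ^ 2) by ring,
    padicValNat.mul (by norm_num) hM]
  simp [add_comm]

/-- Consequence used in T-1728@2: with the level `ℓ = v₂(M) + 1` the Gross–Keating length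
`ℓ + 1` equals `2 + v₂(M)`, i.e. twice it contributes `4 + 2·v₂(M)` per unit `U`;
summed over `U = I, J, K` this is the law `vLaw = 12 + 2·Σ v₂(M_U)` of the companion file.
Stated here as the arithmetic identity it is. -/
theorem length_from_level (vM : ℕ) : (vM + 1) + 1 = 2 + vM := by ring

/-- Anchors: `M = 1` (`U`-part of case A / of `y = (b, 0, ±1)`-type orbits): level `1`,
`v₂(0² + 1² + 1) = 1`; `M = 16 = 0² + 4²` (D = −68, orbit (1,0,4), U = I): `v₂(0 + 16 + 16) = 5
= v₂(16) + 1`; `M = 8 = 2² + 2²` (D = −36, orbit (1,2,2), U = I): `v₂(4 + 4 + 8) = 4`. -/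
theorem anchors :
    padicValNat 2 (0 ^ 2 + 1 ^ 2 + 1) = 1 ∧
    padicValNat 2 (0 ^ 2 + 4 ^ 2 + 16) = 5 ∧
    padicValNat 2 (2 ^ 2 + 2 ^ 2 + 8) = 4 := by
  refine ⟨by norm_num, ?_, ?_⟩
  · rw [show (0 : ℕ) ^ 2 + 4 ^ 2 + 16 = 2 ^ 5 by norm_num, padicValNat.prime_pow]
  · rw [show (2 : ℕ) ^ 2 + 2 ^ 2 + 8 = 2 ^ 4 by norm_num, padicValNat.prime_pow]

end Summit.HodgeConjecture.HodgeConjecture.HodgeLocus.Census.ValJ1728At2Level
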